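import Literature.Barriers.CriticalPhenomena.WeaklySAWPerturbativeBetaMassInsensitivity
import Literature.Barriers.CriticalPhenomena.WeaklySAWPerturbativeBetaMassDecay
import Literature.Barriers.CriticalPhenomena.WeaklySAWFlowStructuralStability
import HarnessLib

/-!
# BBS 2015, §6.1: Assumption (A1) HOLDS for the weakly self-avoiding walk in `d = 4` —
# [BBS-rg-pt] Proposition 4.2.2 (the `β`-part) for the explicit `β_j(m²)`, with `j_Ω = j_m + O(1)`

End point of the `β_j` line of this series (`WeaklySAWPerturbativeBeta*.lean`,
`FiniteRangeDecomposition*.lean`): Bauerschmidt–Brydges–Slade, CMP 337 (2015) [BBS2015], §6.1 —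

"**Assumption (A1).** The sequence `β`: The sequence `(β_j)` is bounded, namely
`β_max = sup_{j∈ℕ₀}|β_j| < ∞`. There exists `c > 0` such that `β_j ≥ c` for all but `c⁻¹` values of
`j ≤ j_Ω`", where (the `Ω`-scale) "`j_Ω = inf{k ≥ 0 : |β_j| ≤ Ω^{-(j-k)}‖β‖_∞ for all j}`", "For
the remainder of the paper, we fix `Ω > 1` arbitrarily", and "In [BBS-rg-pt], it is verified that
… the following two assumptions are satisfied" —

for the explicit sequence `β_j(m²) = CTWSAW.betaPT 4 L m² j` of §6.1, in the tree's formalization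
`CTWSAW.HypA1 β Ω B c` of Assumption (A1) (`WeaklySAWFlowStructuralStability.lean`, with
`CTWSAW.jOmega`, `CTWSAW.betaMax`), following the proof of Proposition 4.2.2 of R. Bauerschmidt,
D. C. Brydges, G. Slade, *A renormalisation group method. III. Perturbative analysis*, J. Stat.
Phys. **159** (2015), arXiv:1403.7252 [BBS-rg-pt], §6.3: "Fix `c, n` as in Lemma 6.3.1. Since
`j_m → ∞` as `m ↓ 0`, there is a `δ` such that `j_m > n` when `m² ∈ [0,δ]`. For such `m`, it follows
from Lemma 6.3.1 that `‖β‖_∞ ≥ c`. We apply Lemma 6.1.2 and (mchibd) to see that there is a constant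
`C` such that `|β_j| ≤ CΩ^{-(j-j_m)₊} ≤ (C/c)Ω^{-(j-j_m)₊}‖β‖_∞ ≤ Ω^{-(j-k)₊}‖β‖_∞` whenever
`k ≥ j_m + log_Ω(C/c)`. In particular, `j_Ω ≤ k` and thus `j_Ω ≤ j_m + O(1)`. On the other hand, by
Lemma 6.3.1, `β_{j_m-n} ≥ c`, and the definition of `j_Ω` thus requires that
`c ≤ β_{j_m-n} ≤ Ω^{-(j_m-n-j_Ω)₊}‖β‖_∞`. Therefore, `j_m - n - j_Ω ≤ log_Ω(c⁻¹‖β‖_∞)` … Also, the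
number of `j ≤ j_Ω` with `β_j < c` is bounded by `n + log_Ω(C/c)`. This proves [(A1)]".

## What this file proves (everything; no definition, no named fact)

* `exists_massScale` — the mass scale: for `s ∈ (0,1]`, `L > 1` there is `j_m` (`= ⌊log_{L²}s⁻¹⌋`)
  with `sL^{2j_m} ≤ 1 < sL^{2(j_m+1)}`; `le_massScale_of_le` ("`j_m → ∞` as `m ↓ 0`", quantified);
* `jOmega_le_of_cutoff` — "`j_Ω ≤ j_m + log_Ω(C/c)`" (abstract: decay `|β_j| ≤ CΩ^{-(j-j_m)₊}` and one
  `β_{j₀} ≥ c > 0` force `j_Ω ≤ j_m + K₀` once `Ω^{K₀} > C/c`); `le_jOmega_add` — "`j_Ω ≥ j_m - n -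
  log_Ω(c⁻¹‖β‖_∞)`" (abstract);
* `jOmega_betaPT_zero` — at `m² = 0`, `j_Ω = ∞` (`β_j(0) → β̄_L > 0`);
* **`jOmega_betaPT_massScale`** — `j_Ω = j_m + O(1)` uniformly in `m² ∈ (0,δ]`: there are `δ > 0`
  and `M` with `j_Ω ≤ j_m + M` and `j_m ≤ j_Ω + M`;
* **`hypA1_betaPT`** — Assumption (A1) for the weakly self-avoiding walk: for `L ≥ 2`, `Ω > 1` there
  are `δ ∈ (0,1]`, `B`, `c` with `HypA1 (betaPT 4 L m²) Ω B c` for every `m² ∈ [0,δ]` (uniform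
  constants: `B = KL⁴`, `c = min(β̄_L/2, 1/(2n+K₀+1))`, exceptional set `{j < n} ∪ (j_m-n, j_m+K₀]`).
-/

noncomputable section

open Set Filter Topology
open Literature.Probability.LatticeModels
open scoped BigOperators

namespace Literature.Barriers.CriticalPhenomena

namespace CTWSAW

open LongRangePhi4 LongRangePhi4.FRD

/-! ### The mass scale -/

/-- **The mass scale**: for `s ∈ (0,1]` and `L > 1` there is `j_m ∈ ℕ` (namely `⌊log_{L²}s⁻¹⌋`) with
`sL^{2j_m} ≤ 1 < sL^{2(j_m+1)}`. [cite: BauerschmidtBrydgesSlade2015LogCorr, §6.1 ("the mass scale, i.e., the smallest j such that L^{2j}m² ≥ 1"; [BBS-rg-pt] (jmdef): j_m = ⌊log_{L²}m⁻²⌋)] -/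
theorem exists_massScale {L : ℝ} (hL : 1 < L) {s : ℝ} (hs : 0 < s) (hs1 : s ≤ 1) :
    ∃ jm : ℕ, s * L ^ (2 * jm) ≤ 1 ∧ 1 < s * L ^ (2 * (jm + 1)) := by
  classical
  have hL2 : 1 < L ^ 2 := by nlinarith
  have hex : ∃ k : ℕ, 1 < s * L ^ (2 * k) := by
    obtain ⟨k, hk⟩ := pow_unbounded_of_one_lt (1 / s) hL2
    refine ⟨k, ?_⟩
    rw [pow_mul]
    rw [div_lt_iff₀ hs] at hk
    linarith
  set m := Nat.find hex with hm
  have hspec : 1 < s * L ^ (2 * m) := Nat.find_spec hex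
  have hm0 : m ≠ 0 := by
    intro h0
    rw [h0, mul_zero, pow_zero, mul_one] at hspec
    linarith
  refine ⟨m - 1, ?_, ?_⟩
  · have hlt : m - 1 < m := by omega
    have := Nat.find_min hex hlt
    push Not at this
    exact this
  · rwa [Nat.sub_add_cancel (Nat.one_le_iff_ne_zero.2 hm0)]

/-- "`j_m → ∞` as `m ↓ 0`", quantified: if `sL^{2N} ≤ 1` and `sL^{2(j_m+1)} > 1` then `N ≤ j_m`
(`L > 1`, `s > 0`). [cite: BauerschmidtBrydgesSlade2015LogCorr, §6.1 (mass scale; [BBS-rg-pt] proof of Proposition 4.2.2: "j_m → ∞ as m ↓ 0")] -/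
theorem le_massScale_of_le {L : ℝ} (hL : 1 < L) {s : ℝ} (hs : 0 < s) {N jm : ℕ}
    (hN : s * L ^ (2 * N) ≤ 1) (hjm : 1 < s * L ^ (2 * (jm + 1))) : N ≤ jm := by
  by_contra h
  push Not at h
  have h1 : L ^ (2 * (jm + 1)) ≤ L ^ (2 * N) := pow_le_pow_right₀ hL.le (by omega)
  have h2 : s * L ^ (2 * (jm + 1)) ≤ s * L ^ (2 * N) := mul_le_mul_of_nonneg_left h1 hs.le
  linarith

/-! ### `j_Ω` against the mass scale (abstract) -/

/-- `j_Ω ≤ k` as soon as `k` is admissible (`|β_j| ≤ Ω^{-(j-k)₊}β_max` for all `j`). [cite: BauerschmidtBrydgesSlade2015LogCorr, §6.1 (definition of j_Ω as an infimum)] -/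
theorem jOmega_le_of_admissible {β : ℕ → ℝ} {Ω : ℝ} {k : ℕ}
    (hk : ∀ j, |β j| ≤ (Ω ^ (j - k))⁻¹ * betaMax β) : jOmega β Ω ≤ (k : ℕ∞) := by
  show (⨅ (k : ℕ) (_ : ∀ j, |β j| ≤ (Ω ^ (j - k))⁻¹ * betaMax β), (k : ℕ∞)) ≤ k
  exact iInf₂_le k hk

/-- **"`j_Ω ≤ j_m + log_Ω(C/c)`"** (abstract form): if `β` is bounded, `|β_j| ≤ CΩ^{-(j-j_m)₊}` for all
`j`, some `β_{j₀} ≥ c > 0`, and `Ω^{K₀} > C/c`, then `j_Ω ≤ j_m + K₀` (for `j > j_m + K₀`: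
`|β_j| ≤ CΩ^{-K₀}Ω^{-(j-j_m-K₀)} ≤ cΩ^{-(j-j_m-K₀)} ≤ β_maxΩ^{-(j-j_m-K₀)}`; for smaller `j`,
`|β_j| ≤ β_max`). [cite: BauerschmidtBrydgesSlade2015LogCorr, §6.1 ([BBS-rg-pt] proof of Proposition 4.2.2: "j_Ω ≤ k whenever k ≥ j_m + log_Ω(C/c)")] -/
theorem jOmega_le_of_cutoff {β : ℕ → ℝ} {Ω C c B : ℝ} (hΩ : 1 < Ω) {jm K₀ j₀ : ℕ}
    (hB : ∀ j, |β j| ≤ B) (hcut : ∀ j, |β j| ≤ C * (Ω ^ (j - jm))⁻¹) (hc : 0 < c)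
    (hK₀ : C / c < Ω ^ K₀) (hgood : c ≤ β j₀) : jOmega β Ω ≤ ((jm + K₀ : ℕ) : ℕ∞) := by
  have hΩ0 : 0 < Ω := by linarith
  have hbdd : BddAbove (Set.range fun j => |β j|) := ⟨B, by rintro _ ⟨j, rfl⟩; exact hB j⟩
  have hmax : ∀ j, |β j| ≤ betaMax β := fun j => le_ciSup hbdd j
  have hmaxc : c ≤ betaMax β := le_trans (hgood.trans (le_abs_self _)) (hmax j₀)
  refine jOmega_le_of_admissible fun j => ?_
  rcases le_or_gt j (jm + K₀) with hj | hj
  · rw [Nat.sub_eq_zero_of_le hj, pow_zero, inv_one, one_mul]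
    exact hmax j
  · have hsplit : j - jm = (j - (jm + K₀)) + K₀ := by omega
    have hCK : C * (Ω ^ K₀)⁻¹ ≤ c := by
      rw [div_lt_iff₀ hc] at hK₀
      rw [← div_eq_mul_inv, div_le_iff₀ (pow_pos hΩ0 _)]
      linarith
    calc |β j| ≤ C * (Ω ^ (j - jm))⁻¹ := hcut j
      _ = (Ω ^ (j - (jm + K₀)))⁻¹ * (C * (Ω ^ K₀)⁻¹) := by rw [hsplit, pow_add, mul_inv]; ring
      _ ≤ (Ω ^ (j - (jm + K₀)))⁻¹ * betaMax β :=
          mul_le_mul_of_nonneg_left (hCK.trans hmaxc) (by positivity)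

/-- **"`j_Ω ≥ j_m - n - log_Ω(c⁻¹‖β‖_∞)`"** (abstract form): if `|β_j| ≤ B` for all `j`,
`β_{j₀} ≥ c > 0` and `Ω^M > B/c`, then `j₀ ≤ j_Ω + M` (the definition of `j_Ω` requires
`c ≤ β_{j₀} ≤ Ω^{-(j₀-j_Ω)₊}β_max ≤ Ω^{-(j₀-j_Ω)₊}B`). [cite: BauerschmidtBrydgesSlade2015LogCorr, §6.1 ([BBS-rg-pt] proof of Proposition 4.2.2: "j_Ω ≥ j_m - n - log_Ω(c⁻¹‖β‖_∞)")] -/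
theorem le_jOmega_add {β : ℕ → ℝ} {Ω c B : ℝ} (hΩ : 1 < Ω) (hB : ∀ j, |β j| ≤ B) (hc : 0 < c)
    {j₀ M : ℕ} (hgood : c ≤ β j₀) (hM : B / c < Ω ^ M) : (j₀ : ℕ∞) ≤ jOmega β Ω + M := by
  have hΩ0 : 0 < Ω := by linarith
  induction h : jOmega β Ω with
  | top => simp
  | coe k =>
    have hspec := jOmega_spec h j₀
    have hmaxB : betaMax β ≤ B := ciSup_le fun j => hB j
    have h1 : c ≤ (Ω ^ (j₀ - k))⁻¹ * B :=
      hgood.trans ((le_abs_self _).trans (hspec.trans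
        (mul_le_mul_of_nonneg_left hmaxB (by positivity))))
    have h2 : Ω ^ (j₀ - k) ≤ B / c := by
      rw [le_div_iff₀ hc]
      have := mul_le_mul_of_nonneg_left h1 (pow_pos hΩ0 (j₀ - k)).le
      rw [← mul_assoc, mul_inv_cancel₀ (pow_pos hΩ0 _).ne', one_mul] at this
      linarith
    have h3 : j₀ - k < M := (pow_lt_pow_iff_right₀ hΩ).1 (h2.trans_lt hM)
    have h4 : j₀ ≤ k + M := by omega
    exact_mod_cast h4

/-! ### `j_Ω` for the explicit `β` -/

/-- **At `m² = 0`, `j_Ω = ∞`** for the explicit `β` (`L ≥ 2`, `Ω > 1`): a finite `j_Ω = k` would force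
`|β_j(0)| ≤ Ω^{-(j-k)}β_max → 0`, contradicting `β_j(0) → β̄_L > 0`.
[cite: BauerschmidtBrydgesSlade2015LogCorr, §6.1 ("lim_{j→∞}β_j = log L/π² for m² = 0, so β_j is bounded away from 0 for sufficiently large j"; [BBS-rg-pt] Proposition 4.2.2: "j_m = j_Ω = ∞ if m² = 0")] -/
theorem jOmega_betaPT_zero {L : ℝ} (hL : 2 ≤ L) {Ω : ℝ} (hΩ : 1 < Ω) : jOmega (betaPT 4 L 0) Ω = ⊤ := by
  have hΩ0 : 0 < Ω := by linarith
  by_contra hne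
  obtain ⟨k, hk⟩ := ENat.ne_top_iff_exists.1 hne
  have hspec := jOmega_spec hk.symm
  obtain ⟨K, hK, hB⟩ := BBS2015_A1_bounded
  have hmaxB : betaMax (betaPT 4 L 0) ≤ K * L ^ 4 := ciSup_le fun j => hB L hL 0 le_rfl j
  -- `Ω^{-(j-k)} β_max → 0`
  have hT0 : Tendsto (fun j : ℕ => (Ω ^ (j - k))⁻¹ * betaMax (betaPT 4 L 0)) atTop (𝓝 0) := by
    have h1 : Tendsto (fun j : ℕ => (Ω ^ j)⁻¹) atTop (𝓝 0) := by
      simp_rw [← inv_pow]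
      exact tendsto_pow_atTop_nhds_zero_of_lt_one (by positivity) (inv_lt_one_of_one_lt₀ hΩ)
    have h2 : Tendsto (fun j : ℕ => (Ω ^ (j - k))⁻¹) atTop (𝓝 0) := by
      have := (tendsto_sub_atTop_nat k)
      exact h1.comp this
    simpa using h2.mul_const (betaMax (betaPT 4 L 0))
  have hT := tendsto_betaPT_zero hL
  have hb := betaLim_pos hL
  -- eventually `β_j(0) > β̄/2` and `Ω^{-(j-k)}β_max < β̄/2`
  have hev1 : ∀ᶠ j in atTop, betaLim L / 2 < betaPT 4 L 0 j := hT.eventually (lt_mem_nhds (by linarith))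
  have hev2 : ∀ᶠ j in atTop, (Ω ^ (j - k))⁻¹ * betaMax (betaPT 4 L 0) < betaLim L / 2 :=
    hT0.eventually (gt_mem_nhds (by linarith))
  obtain ⟨j, hj1, hj2⟩ := (hev1.and hev2).exists
  have := hspec j
  have h3 : betaPT 4 L 0 j ≤ |betaPT 4 L 0 j| := le_abs_self _
  linarith

/-- **`j_Ω = j_m + O(1)` uniformly in `m² ∈ (0,δ]`** for the explicit `β` (`L ≥ 2`, `Ω > 1`): there are
`δ ∈ (0,1]` and `M ∈ ℕ` such that for every `s ∈ (0,δ]` and its mass scale `j_m`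
(`sL^{2j_m} ≤ 1 < sL^{2(j_m+1)}`), `j_Ω ≤ j_m + M` and `j_m ≤ j_Ω + M`.
[cite: BauerschmidtBrydgesSlade2015LogCorr, §6.1 ("|j_m - j_Ω| is bounded uniformly as m² ↓ 0"; [BBS-rg-pt] Proposition 4.2.2, display (jmjOmega))] -/
theorem jOmega_betaPT_massScale {L : ℝ} (hL : 2 ≤ L) {Ω : ℝ} (hΩ : 1 < Ω) :
    ∃ δ : ℝ, 0 < δ ∧ δ ≤ 1 ∧ ∃ M : ℕ, ∀ s : ℝ, 0 < s → s ≤ δ → ∀ jm : ℕ,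
      s * L ^ (2 * jm) ≤ 1 → 1 < s * L ^ (2 * (jm + 1)) →
        jOmega (betaPT 4 L s) Ω ≤ ((jm + M : ℕ) : ℕ∞) ∧ (jm : ℕ∞) ≤ jOmega (betaPT 4 L s) Ω + M := by
  have hL1 : (1 : ℝ) < L := by linarith
  have hL0 : (0 : ℝ) < L := by linarith
  obtain ⟨Kb, hKb, hbnd⟩ := BBS2015_A1_bounded
  have hb := betaLim_pos hL
  obtain ⟨n, hn⟩ := BBSrgpt_lem631 hL (c := betaLim L / 2) (by linarith)
  obtain ⟨C, hC, hcut⟩ := abs_betaPT_le_cutoff hΩ hL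
  obtain ⟨K₀, hK₀⟩ := pow_unbounded_of_one_lt (C / (betaLim L / 2)) hΩ
  obtain ⟨M₁, hM₁⟩ := pow_unbounded_of_one_lt (Kb * L ^ 4 / (betaLim L / 2)) hΩ
  set δ : ℝ := 1 / L ^ (2 * (2 * n)) with hδ
  have hδ0 : 0 < δ := by positivity
  have hδ1 : δ ≤ 1 := by
    rw [hδ, div_le_one (pow_pos hL0 _)]
    exact one_le_pow₀ hL1.le
  refine ⟨δ, hδ0, hδ1, max K₀ (2 * n + M₁), fun s hs hsδ jm hjm1 hjm2 => ?_⟩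
  have hs1 : s ≤ 1 := hsδ.trans hδ1
  -- `sL^{4n} ≤ 1`, so `2n ≤ j_m` and `β_n(s) ≥ β̄/2`
  have hs4n : s * L ^ (2 * (2 * n)) ≤ 1 := by
    have := mul_le_mul_of_nonneg_right hsδ (pow_pos hL0 (2 * (2 * n))).le
    rwa [hδ, one_div, inv_mul_cancel₀ (pow_pos hL0 _).ne'] at this
  have h2n : 2 * n ≤ jm := le_massScale_of_le hL1 hs hs4n hjm2
  have hgood : betaLim L / 2 ≤ betaPT 4 L s n :=
    hn s hs.le hs1 n le_rfl (by rwa [show n + n = 2 * n by ring])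
  have hB : ∀ j, |betaPT 4 L s j| ≤ Kb * L ^ 4 := fun j => hbnd L hL s hs.le j
  constructor
  · have h1 := jOmega_le_of_cutoff hΩ hB (hcut s hs hs1 jm hjm2) (by linarith) hK₀ hgood
    refine h1.trans ?_
    exact_mod_cast Nat.add_le_add_left (le_max_left _ _) jm
  · -- `j_m - n` is good: `β_{j_m-n} ≥ β̄/2`; hence `j_m - n ≤ j_Ω + M₁`
    have hgood' : betaLim L / 2 ≤ betaPT 4 L s (jm - n) := by
      refine hn s hs.le hs1 (jm - n) (by omega) ?_
      rwa [Nat.sub_add_cancel (by omega : n ≤ jm)]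
    have h1 := le_jOmega_add hΩ hB (by linarith) hgood' hM₁
    -- `j_m ≤ (j_m - n) + n ≤ j_Ω + M₁ + n ≤ j_Ω + max K₀ (2n + M₁)`
    have h2 : (jm : ℕ∞) ≤ ((jm - n : ℕ) : ℕ∞) + n := by
      exact_mod_cast (by omega : jm ≤ jm - n + n)
    have h3 : ((M₁ : ℕ) : ℕ∞) + n ≤ ((max K₀ (2 * n + M₁) : ℕ) : ℕ∞) := by
      exact_mod_cast (by omega : M₁ + n ≤ max K₀ (2 * n + M₁))
    calc (jm : ℕ∞) ≤ ((jm - n : ℕ) : ℕ∞) + n := h2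
      _ ≤ jOmega (betaPT 4 L s) Ω + M₁ + n := add_le_add h1 le_rfl
      _ = jOmega (betaPT 4 L s) Ω + (M₁ + n) := by rw [add_assoc]
      _ ≤ jOmega (betaPT 4 L s) Ω + ((max K₀ (2 * n + M₁) : ℕ) : ℕ∞) := by
          exact add_le_add le_rfl h3

/-! ### Assumption (A1) -/

/-- **BBS 2015, Assumption (A1) HOLDS for the weakly self-avoiding walk in `d = 4`**: for `L ≥ 2`
and `Ω > 1` there are `δ ∈ (0,1]`, `B` and `c` such that the explicit `β_j(m²) = betaPT 4 L m² j`
satisfies `HypA1 (β(m²)) Ω B c` for every `m² ∈ [0,δ]` — `|β_j| ≤ B` for all `j`, `c > 0`, and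
`β_j ≥ c` for all but at most `c⁻¹` values of `j ≤ j_Ω` — with constants uniform in `m²`. Proof of
[BBS-rg-pt] Proposition 4.2.2: `B = KL⁴` (boundedness); with `c' = β̄_L/2` and `n` from Lemma 6.3.1,
`C` from `|β_j| ≤ CΩ^{-(j-j_m)₊}` and `Ω^{K₀} > C/c'`: for `m² = 0` every `j ≥ n` is good; for
`m² ∈ (0,δ]`, `δ = L^{-4n}` (`j_m ≥ 2n`, so `β_n ≥ c'` and `β_max ≥ c'`), `j_Ω ≤ j_m + K₀` and every
`j ∈ [n, j_m-n]` is good; exceptional set `{j < n} ∪ (j_m-n, j_m+K₀]`, of size `≤ 2n + K₀ ≤ c⁻¹`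
for `c = min(c', 1/(2n+K₀+1))`.
[cite: BauerschmidtBrydgesSlade2015LogCorr, §6.1, Assumption (A1) ("In [BBS-rg-pt], it is verified that … [it is] satisfied"; [BBS-rg-pt] = arXiv:1403.7252, Proposition 4.2.2 and its proof in §6.3)] -/
theorem hypA1_betaPT {L : ℝ} (hL : 2 ≤ L) {Ω : ℝ} (hΩ : 1 < Ω) :
    ∃ δ B c : ℝ, 0 < δ ∧ δ ≤ 1 ∧ ∀ s : ℝ, 0 ≤ s → s ≤ δ → HypA1 (betaPT 4 L s) Ω B c := by
  classical
  have hL1 : (1 : ℝ) < L := by linarith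
  have hL0 : (0 : ℝ) < L := by linarith
  obtain ⟨Kb, hKb, hbnd⟩ := BBS2015_A1_bounded
  have hb := betaLim_pos hL
  set c' : ℝ := betaLim L / 2 with hc'
  have hc'0 : 0 < c' := by rw [hc']; linarith
  obtain ⟨n, hn⟩ := BBSrgpt_lem631 hL (c := c') (by rw [hc']; linarith)
  obtain ⟨C, hC, hcut⟩ := abs_betaPT_le_cutoff hΩ hL
  obtain ⟨K₀, hK₀⟩ := pow_unbounded_of_one_lt (C / c') hΩ
  set δ : ℝ := 1 / L ^ (2 * (2 * n)) with hδ
  have hδ0 : 0 < δ := by positivity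
  have hδ1 : δ ≤ 1 := by
    rw [hδ, div_le_one (pow_pos hL0 _)]
    exact one_le_pow₀ hL1.le
  set N : ℕ := 2 * n + K₀ + 1 with hN
  have hN0 : (0 : ℝ) < N := by positivity
  set c : ℝ := min c' (1 / (N : ℝ)) with hcdef
  have hc0 : 0 < c := lt_min hc'0 (by positivity)
  have hcc' : c ≤ c' := min_le_left _ _
  have hcinv : (N : ℝ) ≤ c⁻¹ := by
    have h1 : c ≤ (N : ℝ)⁻¹ := by rw [← one_div]; exact min_le_right _ _
    exact (le_inv_comm₀ hc0 hN0).1 h1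
  refine ⟨δ, Kb * L ^ 4, c, hδ0, hδ1, fun s hs hsδ => ?_⟩
  have hs1 : s ≤ 1 := hsδ.trans hδ1
  have hB : ∀ j, |betaPT 4 L s j| ≤ Kb * L ^ 4 := fun j => hbnd L hL s hs j
  refine ⟨hB, hc0, ?_⟩
  rcases hs.lt_or_eq with hs' | hs'
  · -- the massive case
    obtain ⟨jm, hjm1, hjm2⟩ := exists_massScale hL1 hs' hs1
    have hs4n : s * L ^ (2 * (2 * n)) ≤ 1 := by
      have := mul_le_mul_of_nonneg_right hsδ (pow_pos hL0 (2 * (2 * n))).le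
      rwa [hδ, one_div, inv_mul_cancel₀ (pow_pos hL0 _).ne'] at this
    have h2n : 2 * n ≤ jm := le_massScale_of_le hL1 hs' hs4n hjm2
    have hgood : c' ≤ betaPT 4 L s n :=
      hn s hs hs1 n le_rfl (by rwa [show n + n = 2 * n by ring])
    have hJ : jOmega (betaPT 4 L s) Ω ≤ ((jm + K₀ : ℕ) : ℕ∞) :=
      jOmega_le_of_cutoff hΩ hB (hcut s hs' hs1 jm hjm2) hc'0 hK₀ hgood
    refine ⟨Finset.range n ∪ Finset.Ioc (jm - n) (jm + K₀), ?_, fun j hjΩ hjS => ?_⟩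
    · -- cardinality `≤ n + (n + K₀) < N ≤ c⁻¹`
      have hcard : ((Finset.range n ∪ Finset.Ioc (jm - n) (jm + K₀)).card : ℝ) ≤ N := by
        have h1 := Finset.card_union_le (Finset.range n) (Finset.Ioc (jm - n) (jm + K₀))
        rw [Finset.card_range, Nat.card_Ioc] at h1
        have h2 : jm + K₀ - (jm - n) = K₀ + n := by omega
        rw [h2] at h1
        have : (((Finset.range n ∪ Finset.Ioc (jm - n) (jm + K₀)).card : ℕ) : ℝ) ≤ ((n + (K₀ + n) : ℕ) : ℝ) := by
          exact_mod_cast h1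
        refine this.trans ?_
        rw [hN]; push_cast; linarith
      exact hcard.trans hcinv
    · rw [Finset.mem_union, Finset.mem_range, Finset.mem_Ioc, not_or, not_lt, not_and_or, not_lt,
        not_le] at hjS
      obtain ⟨hjn, hj2⟩ := hjS
      have hjK : j ≤ jm + K₀ := by exact_mod_cast hjΩ.trans hJ
      have hjm : j ≤ jm - n := by
        rcases hj2 with h | h
        · exact h
        · omega
      refine hcc'.trans (hn s hs hs1 j hjn ?_)
      have h1 : L ^ (2 * (j + n)) ≤ L ^ (2 * jm) := pow_le_pow_right₀ hL1.le (by omega)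
      have h2 := mul_le_mul_of_nonneg_left h1 hs
      linarith
  · -- the critical case `s = 0`
    subst hs'
    refine ⟨Finset.range n, ?_, fun j _ hjS => ?_⟩
    · rw [Finset.card_range]
      refine le_trans ?_ hcinv
      rw [hN]; push_cast; linarith
    · rw [Finset.mem_range, not_lt] at hjS
      exact hcc'.trans (hn 0 le_rfl zero_le_one j hjS (by simp))

end CTWSAW

end Literature.Barriers.CriticalPhenomena
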